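import Mathlib
import HarnessLib
import HarnessLib.Audit
import Summits.NavierStokesRegularity.Statement
import Summits.NavierStokesRegularity.NavierStokesRegularity.Theorems.NoBlowupToClay
import Literature.Analysis.FluidPDE.ClassicalSolution
import Literature.Analysis.FluidPDE.LerayHopf
import Literature.Analysis.FluidPDE.NSWave0
import Literature.Analysis.FluidPDE.VectorCalculus
import Literature.Analysis.FluidPDE.SuitableWeak
import Literature.Analysis.FluidPDE.TypeIAncientMild
import HarnessLib.Audit.Status.Attr

/-!
Route: LerayQuarterDissipation

# Route LerayQuarterDissipation — Enstrophy at Leray's quarter rate forces velocity Type I and a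
finite-dissipation profile; kill that profile

D-0145 LINE (ideator seat ns-idea-3, technique card «splitting / non-equivalent criterion search»;
bears_on rung N0 = Clay (A), hard cores stmt-NavierStokesRegularity-1217 NoTypeI and
stmt-NavierStokesRegularity-0056 NoTypeII; NO summit is proved by this line). It suffices to show X
= EQL ∧ FDL: (EQL, shared verbatim with route StretchingWellBinding,
stmt-NavierStokesRegularity-1574) every maximal classical Leray–Hopf solution from a rapidly
decaying datum has enstrophy at exactly Leray's quarter rate, ∫|curl u(t)|² ≤ K/√(T−t); and (FDL,
new) FINITE-DISSIPATION TYPE-I LIOUVILLE: a Type-I ancient mild solution in the KNSS gauge whose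
slices have GLOBAL dissipation ∫_ℝ³|∇ū(s)|² ≤ K/√(−s) is bounded at the apex. The split runs along
the NON-EQUIVALENT pair of blow-up criteria «enstrophy Type I (eI)» / «velocity Type I (vI)»: the
provable RECORD-TIME CAPACITY LEMMA (support RecordTimeTypeI: ‖∇u(t)‖²₂ ≥ c·ν·‖u(t)‖_∞ at
running-maximum times, by KNSS smoothing on a Reynolds-one window + the Sobolev capacity of the
half-maximum ball) gives eI ⇒ vI, so EQL DISCHARGES NoTypeII with no residual; and the zoom at a
singular point of an eI blow-up (support DissipativeZoom: the in-tree singular zoom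
`singularZoom_zoomLimit` plus Fatou on the scale-invariant quantity λ‖∇u(T+λ²s)‖²₂) lands in the
strict sub-stratum 𝒟 = {Type-I ancient mild, ∇ū(s) ∈ L²(ℝ³) at the quarter rate} of the KNSS class
A_C, so only FDL = (L′)|𝒟 is needed, not (L′) and not SWB's NoLocalTypeISingularity.
Lean: `EnstrophyQuarterLaw ∧ FiniteDissipationLiouville`

## Assembly
Pure logic over the four items plus two in-tree theorems (glue.lean `closes`, lean check rc 0, 0
sorry): `navierStokesRegularity_of_noBlowup` (Theorems/NoBlowupToClay.lean) reduces Clay (A) to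
«every classical Leray–Hopf solution on [0,T) from a rapidly decaying datum extends past T»; by
contradiction the solution is maximal, EQL gives K, RecordTimeTypeI gives `IsTypeIBlowup u T`,
`exists_singularPoint_of_classical_of_not_hasSmoothExtensionPast` (Lemarié-Rieusset Thm 15.1 (C), in
tree) gives a backward-singular point, DissipativeZoom gives a profile in 𝒟 singular at the apex,
FDL says it is bounded there — contradiction.

Rationale: WHY THIS LINE. Mechanism: two blow-up rate criteria that are NOT equivalent — Leray's enstrophy
quarter law ‖∇u(t)‖²₂ ≍ (T−t)^(−1/2) (Leray1934 §§19–22 lower bound, in tree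
`leray_blowup_rate_top`; RobinsonRodrigoSadowski2016 Thm 6.8/(6.8)) and the velocity Type-I rate
‖u(t)‖_∞ ≲ (T−t)^(−1/2) (KochNadirashviliSereginSverak2009, SereginSverak2009, AlbrittonBarker2019)
— are ordered ONE way by an elementary capacity argument (eI ⇒ vI: at a running-maximum time the
speed stays ≥ A/2 on a ball of radius cν/A around the maximiser by KNSS smoothing at Reynolds number
one, and Sobolev Ḣ¹ ⊂ L⁶ prices that plateau at ‖∇u‖²₂ ≥ cνA), and the STRONGER criterion passes to
the blow-up profile as a GLOBAL law (∫_ℝ³|∇ū(s)|² ≤ K/√(−s): the quantity λ‖∇u(T+λ²s)‖²₂ is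
scale-invariant and lower-semicontinuous under the zoom). Route StretchingWellBinding (rev 9) holds
the same quarter law but feeds it only into Albritton–Barker's LOCAL scaled-energy Type I (its
proved TypeIBridge) and is then left with the full hard statement NoLocalTypeISingularity =
¬LocalTypeISingularityExists; this line keeps the global information and asks only for Liouville on
the finite-dissipation stratum 𝒟 ⊊ A_C, where energy methods are legal: ū(s) ∈ Ḣ¹(ℝ³) ⊂ L⁶ with
‖ū(s)‖_6 ≤ C√K(−s)^(−1/4) → 0 in the far past (a SUBCRITICAL norm, lifespan ≳ ‖ū(s)‖_6^(−4) ≍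
K^(−2)(−s): for K below an absolute constant the L⁶ local solution started at time s lives past s =
0, so small-K members of 𝒟 are regular at the apex — the line's first rung), the self-similar
members are dead by Tsai1998 Thm 2 (local energy class, in tree), and the λ-DSS members have profile
V(τ) ∈ L^∞_τ Ḣ¹ so the Nečas–Růžička–Šverák/Tsai head-pressure maximum principle can be run on the
log-time period for every λ (plan), where ChaeWolf2017Removing is perturbative near λ = 1 only.
Imported from: parabolic capacity / Sobolev (elliptic regularity theory), nothing cross-field. What
it does that prior routes and the negatives index do not: no listed route types the eI/vI ordering
or the stratum 𝒟 (census 2026-08-27 over 113 Theses: «finite dissipation»/«∇U ∈ L²» profile classes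
0, quarter law only in StretchingWellBinding/AmplitudeIndex (Leray-variables enstrophy INDEX, a
different object)); none of the five refuted NS statements (stmt-1376, 4055, 1832, 1429, 0154)
concerns enstrophy rates or Ḣ¹ profiles.

RANKED CRUXES. #2 FiniteDissipationLiouville (crux) — FINITE-DISSIPATION TYPE-I LIOUVILLE
(regularity form, = (L′) restricted to the stratum 𝒟): for all C, K and every Type-I ancient mild
solution ū in the KNSS gauge with constant C (in-tree class `IsTypeIAncientMild C ū`: C^∞ on t<0,
divergence-free, Oseen–Duhamel identity between all pairs of negative times, |ū(t,x)| ≤ C/√(−t))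
whose slices obey the GLOBAL quarter-rate dissipation law ∫_ℝ³ ‖∇ū(s)‖² ≤ K/√(−s) for all s<0, ū is
bounded on some backward parabolic cylinder at the space-time origin (it is NOT the case that ū
exceeds every bound in every Q((0,0),r)). Strictly weaker than (L′) (stmt-4050 / SqueezeLiouville
class) and than SWB's NoLocalTypeISingularity; contains backward λ-DSS exclusion for Ḣ¹ profiles,
all λ. [difficulty: open-problem] (why it might fail: A backward λ-DSS Type-I profile with V ∈
Ḣ¹(ℝ³) (λ far from 1, outside ChaeWolf2017's window) would lie in 𝒟 and be singular at the apex;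
nothing known excludes it, and Landau-tailed profiles (|∇ū| ~ |y|⁻²) also have finite dissipation.)
[KochNadirashviliSereginSverak2009, AlbrittonBarker2019, Tsai1998, ChaeWolf2017Removing,
NecasRuzickaSverak1996, Seregin2014Notes]
#3 EnstrophyQuarterLaw (crux) — ENSTROPHY QUARTER LAW (shared verbatim with route
StretchingWellBinding, item stmt-NavierStokesRegularity-1574): a maximal classical solution on [0,T)
which is Leray–Hopf from a rapidly decaying datum has ∫|curl u(t)|² ≤ K/√(T−t) on [0,T) for some K —
dissipation blows up at exactly Leray's lower-bound rate. Consequence of Clay (A) (vacuous then),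
content = «every finite-energy blow-up is enstrophy-Type-I»; by the support RecordTimeTypeI it
implies velocity Type I, hence discharges NoTypeII (stmt-0056) inside this route. [difficulty:
open-problem] (why it might fail: It says every blow-up runs at Leray's minimal enstrophy rate; no
upper bound on any NS blow-up rate is known (Tao2021: triple-log lower bounds only), and a Type-II
scenario (Hou2022 axisymmetric numerics, enstrophy growing faster than (T−t)^(−1/2)) kills it.)
[Leray1934, RobinsonRodrigoSadowski2016, Tao2021QuantitativeNS, Hou2022PotentiallySingularNS,
LuDoering2008]
#9 RecordTimeTypeI (support) — RECORD-TIME CAPACITY LEMMA (eI ⇒ vI): for a classical Leray–Hopf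
solution on [0,T) from a rapidly decaying datum, the quarter-rate enstrophy bound ∫|curl u(t)|² ≤
K/√(T−t) on [0,T) implies the velocity Type-I rate `IsTypeIBlowup u T` (‖u(t)‖_∞ ≤ C′/√(T−t)
eventually). Proof sketch: at a time t where ‖u(t)‖_∞ = A is at least half the running maximum, |u|
≤ 2A on [t−ν/A², t]×ℝ³, so KNSS/Kato smoothing gives ‖∇u(t)‖_∞ ≤ C₀A²/ν, hence |u(t)| ≥ A/2 on a
ball of radius ν/(4C₀A) about a near-maximiser, and Sobolev Ḣ¹(ℝ³) ⊂ L⁶ gives ‖∇u(t)‖²₂ = ‖curl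
u(t)‖²₂ ≥ cνA; the running maximum is attained at such times, so ‖u(t)‖_∞ ≤ K/(cν√(T−t)) for all t.
[difficulty: M] [KochNadirashviliSereginSverak2009, Leray1934, RobinsonRodrigoSadowski2016]
#9 DissipativeZoom (support) — DISSIPATIVE ZOOM: at a backward-singular point (T,x₀) of a
velocity-Type-I classical Leray–Hopf solution from a rapidly decaying datum obeying the quarter-rate
enstrophy bound with constant K, some KNSS/Albritton–Barker zoom limit ū is a Type-I ancient mild
solution in the KNSS gauge, obeys the GLOBAL dissipation law ∫_ℝ³‖∇ū(s)‖² ≤ K′/√(−s) for all s<0,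
and is unbounded on every backward cylinder at the origin. Proof sketch: the in-tree
`singularZoom_zoomLimit` (Theorems/SqueezeCycleSingularZoom.lean) supplies the profile and its apex
singularity; the rescaled gradients (αR)·∇u(T+β s, x₀+R y) have ∫_ℝ³|·|²dy = λ‖∇u(t)‖²₂ ≤
K(−s)^(−1/2)·ν-factor (scale invariance of the quarter law, ‖∇u‖₂ = ‖curl u‖₂ for divergence-free H¹
fields), and Fatou/lower semicontinuity under the weak L²_loc convergence of gradients used in that
proof passes the bound to ū. [difficulty: L] [AlbrittonBarker2019,
KochNadirashviliSereginSverak2009, SereginSverak2009, LemarieRieusset2016]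

TWO-LAYER PLAN. FDL ⇐ FDL_dss → FDL_rec → FDL foreseen: (FDL_dss) no backward λ-DSS member of 𝒟 is
singular, all λ (Tsai's head-pressure maximum principle on the log-time period); (FDL_rec) a
singular member of 𝒟 has a singular uniformly-recurrent member of 𝒟 in its scaling ω-limit set
(RecurrentProfiles' proved reduction restricted to 𝒟, which is closed under the scaling flow and
under local limits by Fatou); glue: recurrent + Ḣ¹-slices ⇒ DSS-like enough for the period argument
— the genuinely open seam. First rungs (BC5): FDL for K below an absolute constant (L⁶ lifespan
reaches the apex) — provable now.

KILL CRITERIA. Refutation of FDL by an explicit singular Type-I ancient mild solution with Ḣ¹ slices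
(e.g. a backward λ-DSS profile with ∇V ∈ L², or a numerically certified RDSS profile from the ns-dss
engines) closes the route `refuted:FiniteDissipationLiouville`. Refutation of EQL (a finite-energy
blow-up, numerical or rigorous, with enstrophy growing faster than (T−t)^(−1/2), e.g. a certified
Type-II axisymmetric scenario) closes this route AND StretchingWellBinding. If (L′) (stmt-4050) or
SqueezeLiouville is proved elsewhere, FDL is mooted (implied) and the route reduces to EQL.

NOT DECOMPOSED YET. The two supports are provable-now but not split into their bricks (KNSS
smoothing window, Sobolev capacity, curl-vs-gradient L² identity, Fatou under the zoom); the DSS and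
small-K sub-cases of FDL are layer-2 children to be filed only after the tribunal; no constant (c,
C₀, the small-K threshold) is fixed in a statement — all are existential.

CHEAPEST FALSIFIER. For FDL: take the Bradshaw–Tsai / Chae–Wolf λ-DSS ansatz and ask whether a
BACKWARD λ-DSS profile can have ∇V ∈ L²(ℝ³): the far field of any DSS profile is |V(z)| ~
a(ẑ,τ)/|z|, so ∇V ~ |z|⁻² ∈ L² at infinity automatically — hence FDL is killed by ANY singular
backward DSS Type-I profile, and the instrument row that would refute it is the pub-ns-dss RDSS
engine (LADDER-NS N7 «ns-dss RDSS engines», N6c backward-DSS exclusion): one converged backward RDSS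
profile at any λ refutes FDL. For EQL: the N7 DNS/Hou-type enstrophy growth exponents — a certified
run with ∫|ω|² ≳ (T−t)^(−1/2−δ) refutes it. Run by me: none possible in-session (no profile is
known); lookup: no backward DSS profile exists in print (BradshawTsai2017 forward only; ChaeWolf2017
excludes λ near 1).

NUMBERS. Leray's lower bound ‖∇u(t)‖₂ ≥ c ν^(3/4)(T−t)^(−1/4) (RobinsonRodrigoSadowski2016 Thm
6.8/(6.8); tree `leray_blowup_rate_top`); KNSS gap constant c₀ = 1/(πκ) for Type-I ancient
triviality (tree `typeI_ancient_eq_zero_of_timeConstant_lt_one`, route ExtremalTypeIConstant); L⁶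
lifespan T ≳ ν³‖u₀‖_6^(−4) (subcritical local theory), giving the small-K rung K < c_* absolute
after ν = 1 normalisation; Chae–Wolf DSS window |λ − 1| < λ_*(C).

DEFINITION REQUESTS. None: every notion is in tree (`IsTypeIAncientMild`, `IsTypeIBlowup`,
`parabolicCylinder`, `curl`, lintegral enorm).

Novelty: Searches (2026-08-27): census of 113 NS Theses («finite dissipation|∇U ∈ L²|enstrophy Type|Leray
rate|record time|L⁶»: 𝒟 and eI⇒vI 0 hits); lit --hybrid/vsearch; [corpus:paper:arxiv-1610.09464
p.3]; [corpus:paper:arxiv-1108.1165 p.6–7]; [corpus:paper:arxiv-2211.16215 p.15]; galaxy --star all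
([galaxy:pdf:3327933239271363760] only); negatives: 5, none on rates/profiles.
Nearest prior art: SELF-SIMILAR members of 𝒟 known trivial (quarter law ⇔ ∇U ∈ L²(ℝ³) ⇒ U ≡ 0:
NecasRuzickaSverak1996, Tsai1998 Thm 2 in tree); near-one backward λ-DSS removed, all-λ open
(ChaeWolf2017Removing Thm 1.1/1.3, Rem 1.4); in tree GaldiLiouvilleGate stmt-0893 (UNIFORMLY bounded
enstrophy ⇒ v ≡ 0, contains Galdi's steady problem), HubbleDynamo stmt-1934/1935 (double-cone
Liouville + envelope law), StretchingWellBinding stmt-1574/10480 (quarter law ∧ no LOCAL Type-I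
singularity), LandauTail stmt-1947; KNSS2009 (L); AlbrittonBarker2019; LOWER local quarter law at
Type-I points known (Barker–Prange CMP 2021 doi:10.1007/s00220-021-04122-x) — EQL is the matching
UPPER law.
Delta: Liouville asked only on 𝒟 = {Type-I ancient mild, KNSS gauge, dissipation at the quarter RATE
∫|∇ū(s)|² ≤ K/√(−s)}: vs 0893 (CORRECTED 2026-08-28 per ns-lqd-p1 p590032): ParabolicGaldiLiouville
0893 ⇒ FDL and ⇒ RDL by the time-shift v(t)=ū(t−δ) (bounded ancient mild, uniform enstrophy 3K/√δ,
L⁶ slices), so FDL sits strictly BELOW 0893, 4050 and KNSS (L) in logical strength — DAG 0893 ⇒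
22144 ⟺ 22508 ⇒ TypeIDSSLiouvilleConjecture (p  [refs: 10.1007/s00220-021-04122-x, paper:arxiv-1610.09464, paper:arxiv-1108.1165, paper:arxiv-2211.16215, doi:10.1007/s00220-021-04122-x, NecasRuzickaSverak1996, Tsai1998, KNSS2009, AlbrittonBarker2019]

Barriers (technique_class: liouville-ancient, blowup-zoom, enstrophy-rate): - technique_class: liouville-ancient, blowup-zoom, enstrophy-rate
- Literature.Barriers.NavierStokesRegularity.EnstrophyODENoGlobalClosure: EQL is an UPPER bound at
Leray's rate and is NOT derived from the cubic enstrophy law y′ ≤ by³ (which the barrier shows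
closes only locally); the route treats EQL as an open crux whose content is dynamical (SWB's
spectral form), outside the ODE-comparison class.
- Literature.Barriers.NavierStokesRegularity.AveragedTypeIBlowup: Tao-class averaged equations blow
up at the Type-I rate, so FDL cannot follow from estimates shared by the averaged class; it does not
evade this abstractly — the bet is that the exact divergence structure (local energy identity,
head-pressure maximum principle of NRS/Tsai, Sobolev capacity of real velocity plateaus) is used at
every step, none of which survives averaging.
- Literature.Barriers.NavierStokesRegularity.NearOneDssTypeIExclusion: FDL restricted to DSS members
would require all-λ backward DSS exclusion, beyond Chae–Wolf's near-one window; the route's how: on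
𝒟 the DSS profile has V ∈ L^∞_τ Ḣ¹(ℝ³), the hypothesis under which the λ-free NRS/Tsai Π-argument
(not the perturbative near-one argument) is available on the log-time period — this is the declared
plan for the first open rung, not a claim.
- Literature.Barriers.NavierStokesRegularity.EnergySupercriticality: both cruxes are scale-invariant
statements (quarter law and 𝒟 are dimensionless), so the supercritical-energy obstruction to direct
a-priori con

sub-problem: NavierStokesRegularity · status: open · opened planner-ns-idea-3-g0-0 2026-08-27T20:34:42Z · rev 6 · ledger route-NavierStokesRegularity-LerayQuarterDissipation
GENERATED by the gate from the ledger (D-0016/17). Provers cite these decls: `theorem foo : Summit.NavierStokesRegularity.NavierStokesRegularity.Theses.LerayQuarterDissipation.<Decl> := …` in Summits/NavierStokesRegularity/NavierStokesRegularity/Theorems/<Name>.lean.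
-/

namespace Summit.NavierStokesRegularity.NavierStokesRegularity.Theses.LerayQuarterDissipation

open scoped BigOperators Topology Manifold Classical MeasureTheory ProbabilityTheory Matrix InnerProductSpace ComplexConjugate ContinuousMap
open Filter Set Function TopologicalSpace MeasureTheory

attribute [summit_statement] _root_.NavierStokesRegularity

open Literature.NS

/-- item stmt-NavierStokesRegularity-22144 · crux · rank 2 · SPLIT (gen 1) into RecurrentReductionD, RecurrentDissipativeLiouville + glue FiniteDissipationLiouvilleGlue · direct attempts still welcome (low priority) · by planner
why it might fail: A singular backward-DSS member of D for some λ away from 1 (Bradshaw–Tsai OP 5.1 open) refutes it; FDL ⇒ TypeIDSSLiouvilleConjecture (p588754), so it is blocked on the DSS wall; 0893 ⇒ FDL (p590032) places it below Galdi–parabolic Liouville.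
sources: BradshawTsai2017CPDE, ChaeWolf2017RemovingDSS, KochNadirashviliSereginSverak2009
[crux] FINITE-DISSIPATION TYPE-I LIOUVILLE (regularity form, = (L′) restricted to the stratum 𝒟):
for all C, K and every Type-I ancient mild solution ū in the KNSS gauge with constant C (in-tree
class `IsTypeIAncientMild C ū`: C^∞ on t<0, divergence-free, Oseen–Duhamel identity between all
pairs of negative times, |ū(t,x)| ≤ C/√(−t)) whose slices obey the GLOBAL quarter-rate dissipation
law ∫_ℝ³ ‖∇ū(s)‖² ≤ K/√(−s) for all s<0, ū is bounded on some backward parabolic cylinder at the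
space-time origin (it is NOT the case that ū exceeds every bound in every Q((0,0),r)). Strictly
weaker than (L′) (stmt-4050 / SqueezeLiouville class) and than SWB's NoLocalTypeISingularity;
contains backward λ-DSS exclusion for Ḣ¹ profiles, all λ. [difficulty: open-problem] -/
@[route_item "route-NavierStokesRegularity-LerayQuarterDissipation", crux]
def FiniteDissipationLiouville : Prop :=
  ∀ (C K : ℝ) (ū : ℝ → EuclideanSpace ℝ (Fin 3) → EuclideanSpace ℝ (Fin 3)), Literature.Analysis.FluidPDE.IsTypeIAncientMild C ū → (∀ s : ℝ, s < 0 → ∫⁻ x, ‖fderiv ℝ (ū s) x‖ₑ ^ 2 ≤ ENNReal.ofReal (K / Real.sqrt (-s))) → ¬ (∀ r > 0, ∀ M : ℝ, ∃ t ∈ Set.Ioo (-(r ^ 2)) (0 : ℝ), ∃ x ∈ Metric.ball (0 : EuclideanSpace ℝ (Fin 3)) r, M < ‖ū t x‖)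

-- parent: FiniteDissipationLiouville · child (gen 1)
/--     item stmt-NavierStokesRegularity-22508 · crux · rank 202 · open
    parent: FiniteDissipationLiouville · by planner
    why it might fail: FDL ⟺ RDL (p589192): the recurrent (Birkhoff-minimal) hull element keeps the dissipation law but no monotone functional on it is known; any all-λ backward-DSS profile in D refutes it.
    sources: BradshawTsai2017CPDE, ChaeWolf2017RemovingDSS
[crux; child 2 of the glued split of FiniteDissipationLiouville; bears_on N0 via
FiniteDissipationLiouville and on LADDER-NS N6c (backward-DSS exclusion)] RECURRENT
FINITE-DISSIPATION LIOUVILLE: a Type-I ancient mild solution in the KNSS gauge with the global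
quarter-rate dissipation law ∫|∇w(s)|² ≤ K/√(−s) that is UNIFORMLY RECURRENT under the NS scaling
flow (Birkhoff almost periodic in log-scale, locally uniformly) is bounded on some backward cylinder
at the origin. The meet of two open cruxes: weaker than RecurrentProfiles' RecurrentLiouville
(stmt-1589: all uniformly recurrent A–B Type-I profiles, no dissipation law) and weaker than
FiniteDissipationLiouville (stmt-22144: all of 𝒟); contains the DSS members (backward λ-DSS profiles
with V ∈ Ḣ¹(ℝ³), every λ > 1 — Chae–Wolf 2017 Thm 1.1 makes them regular off the apex with envelope
C/(|y|+√(−s)); removal known only for λ near 1, Thm 1.3, and for small constant, Rem 1.4). Plan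
exposed by the two hypotheses together: recurrence gives an invariant measure on the (compact,
minimal) scaling hull, the Ḣ¹ slices make the Nečas–Růžička–Šverák/Tsai head-pressure identity
integrable, so the λ-free Π-maximum-principle argument can be run o -/
@[route_item "route-NavierStokesRegularity-LerayQuarterDissipation", crux]
def RecurrentDissipativeLiouville : Prop :=
  ∀ (C K : ℝ) (w : ℝ → EuclideanSpace ℝ (Fin 3) → EuclideanSpace ℝ (Fin 3)), Literature.Analysis.FluidPDE.IsTypeIAncientMild C w → (∀ s : ℝ, s < 0 → ∫⁻ x, ‖fderiv ℝ (w s) x‖ₑ ^ 2 ≤ ENNReal.ofReal (K / Real.sqrt (-s))) → (∀ ε > 0, ∀ R > 1, ∃ L > 0, ∀ a : ℝ, ∃ σ ∈ Set.Icc a (a + L), ∀ s ∈ Set.Icc (-(R ^ 2)) (-(R⁻¹) ^ 2), ∀ y ∈ Metric.closedBall (0 : EuclideanSpace ℝ (Fin 3)) R, ‖Real.exp σ • w (Real.exp (2 * σ) * s) (Real.exp σ • y) - w s y‖ ≤ ε) → ¬ (∀ r > 0, ∀ M : ℝ, ∃ t ∈ Set.Ioo (-(r ^ 2)) (0 : ℝ),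 ∃ x ∈ Metric.ball (0 : EuclideanSpace ℝ (Fin 3)) r, M < ‖w t x‖)

-- parent: FiniteDissipationLiouville · child (gen 1)
/--     item stmt-NavierStokesRegularity-22507 · support · rank 201 · closed · proved by Summit.NavierStokesRegularity.NavierStokesRegularity.Theorems.recurrentReductionD_proof (prover)
    parent: FiniteDissipationLiouville · by planner
    sources: AlbrittonBarker2019, KochNadirashviliSereginSverak2009
[support, provable now; child 1 of the glued split of FiniteDissipationLiouville] RECURRENT
REDUCTION INSIDE THE FINITE-DISSIPATION STRATUM: if some Type-I ancient mild solution with the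
global quarter-rate dissipation law (a member of 𝒟) is unbounded on every backward cylinder at the
origin, then so is some member of 𝒟 that is UNIFORMLY RECURRENT under the Navier–Stokes scaling flow
σ ↦ e^σ w(e^{2σ}s, e^σ y) (locally uniform Birkhoff almost periodicity in log-scale, two-sided,
bounded return gaps). = RecurrentProfiles' PROVED RecurrentReduction
(stmt-NavierStokesRegularity-1590, Zorn + Birkhoff in the compact invariant set of origin-singular
profiles) run in the KNSS mild gauge and intersected with 𝒟, which is scaling-invariant (the law
∫|∇w(s)|² ≤ K/√(−s) is dimensionless) and closed under local limits (Fatou / weak lower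
semicontinuity of the Ḣ¹ seminorm slice by slice); the singular clause is closed by persistence of
singularities (AlbrittonBarker2019 Prop 2.3, in tree). Sources: AlbrittonBarker2019,
KochNadirashviliSereginSverak2009, route RecurrentProfiles stmt-1590. -/
@[route_item "route-NavierStokesRegularity-LerayQuarterDissipation"]
def RecurrentReductionD : Prop :=
  ∀ (C K : ℝ) (ū : ℝ → EuclideanSpace ℝ (Fin 3) → EuclideanSpace ℝ (Fin 3)), Literature.Analysis.FluidPDE.IsTypeIAncientMild C ū → (∀ s : ℝ, s < 0 → ∫⁻ x, ‖fderiv ℝ (ū s) x‖ₑ ^ 2 ≤ ENNReal.ofReal (K / Real.sqrt (-s))) → (∀ r > 0, ∀ M : ℝ, ∃ t ∈ Set.Ioo (-(r ^ 2)) (0 : ℝ), ∃ x ∈ Metric.ball (0 : EuclideanSpace ℝ (Fin 3)) r, M < ‖ū t x‖) → ∃ (C' K' : ℝ) (w : ℝ → EuclideanSpace ℝ (Fin 3) → EuclideanSpace ℝ (Fin 3)), Literature.Analysis.FluidPDE.IsTypeIAncientMild C' w ∧ (∀ s : ℝ, s < 0 → ∫⁻ x, ‖fderiv ℝ (w s)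 x‖ₑ ^ 2 ≤ ENNReal.ofReal (K' / Real.sqrt (-s))) ∧ (∀ ε > 0, ∀ R > 1, ∃ L > 0, ∀ a : ℝ, ∃ σ ∈ Set.Icc a (a + L), ∀ s ∈ Set.Icc (-(R ^ 2)) (-(R⁻¹) ^ 2), ∀ y ∈ Metric.closedBall (0 : EuclideanSpace ℝ (Fin 3)) R, ‖Real.exp σ • w (Real.exp (2 * σ) * s) (Real.exp σ • y) - w s y‖ ≤ ε) ∧ (∀ r > 0, ∀ M : ℝ, ∃ t ∈ Set.Ioo (-(r ^ 2)) (0 : ℝ), ∃ x ∈ Metric.ball (0 : EuclideanSpace ℝ (Fin 3)) r, M < ‖w t x‖)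

-- `RecurrentReductionD` holds: proved by `Summit.NavierStokesRegularity.NavierStokesRegularity.Theorems.recurrentReductionD_proof` (its module imports this route file, so no `_holds` link can be stated here).

-- parent: FiniteDissipationLiouville · glue (gen 1)
/--     item stmt-NavierStokesRegularity-22509 · support · rank 203 · closed · proved by Summit.NavierStokesRegularity.NavierStokesRegularity.Theorems.finiteDissipationLiouvilleGlue_proof (prover)
    parent: FiniteDissipationLiouville · GLUE: children ⟹ parent · by planner
RecurrentReductionD → RecurrentDissipativeLiouville → FiniteDissipationLiouville: pure logic (a
singular member of 𝒟 yields a singular uniformly recurrent member, which child 2 forbids);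
kernel-checked locally as finiteDissipationLiouville_of_recurrent in the seat's lqd/Split.lean -/
@[route_item "route-NavierStokesRegularity-LerayQuarterDissipation"]
def FiniteDissipationLiouvilleGlue : Prop :=
  RecurrentReductionD → RecurrentDissipativeLiouville → FiniteDissipationLiouville

-- `FiniteDissipationLiouvilleGlue` holds: proved by `Summit.NavierStokesRegularity.NavierStokesRegularity.Theorems.finiteDissipationLiouvilleGlue_proof` (its module imports this route file, so no `_holds` link can be stated here).

/-- item stmt-NavierStokesRegularity-1574 · crux · rank 3 · open · by planner
why it might fail: Type-II blow-up (enstrophy exceeding Leray's quarter rate along a sequence of times) is excluded by no known mechanism; shared summit-live residual (LQD/QLP/CalmSliceGate/SWB).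
sources: Leray1934, BradshawTsai2017CPDE
[crux] QUARTER LAW / enstrophy at Leray's rate (card F6; absorbs leray-quanta-energy-modulus X_H).
If a finite-energy classical solution from a rapidly decaying datum is maximal at T<oo, then
Omega(t) = int |curl u(t)|^2 <= K (T-t)^{-1/2} on [0,T) for some K (lintegral form: infinite
enstrophy violates it). Leray1934 sec.19-22 gives the matching LOWER bound Omega >= c
nu^{3/2}(T-t)^{-1/2} (in tree: leray_blowup_rate_top family), so the claim is 'dissipation blows up
at exactly Leray's rate'. Spectral form (the card's thesis object): with alpha = xi.(grad u)xi and
Lambda(t) = sup_psi (int alpha_+|psi|^2 - nu int|grad psi|^2)/int|psi|^2 = sup spec(nu Lap +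
alpha_+), one has d/dt log Omega <= 2 Lambda, blow-up forces int_{t0}^t Lambda >= (1/4) log(1/(T-t))
- C, and the crux is equivalent to int_{t0}^t (Lambda_eff - 1/(4(T-s))) ds = O(1) with Lambda_eff :=
(1/2) d/dt log Omega <= Lambda: 'Type II <=> the stretching well binds more than a quarter per unit
log-time'. Consequences (not filed): E(Q(z,r)) = r^{-1} intint_Q |grad u|^2 <= 2K/nu-scaled for
EVERY parabolic ball below T (uniform rescaled-energy Type I => TypeIBridge); expected, to be
checked (leray-quanta graft): finitely many s -/
@[route_item "route-NavierStokesRegularity-LerayQuarterDissipation", crux]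
def EnstrophyQuarterLaw : Prop :=
  ∀ (ν T : ℝ), 0 < ν → 0 < T → ∀ (u : ℝ → EuclideanSpace ℝ (Fin 3) → EuclideanSpace ℝ (Fin 3)) (p : ℝ → EuclideanSpace ℝ (Fin 3) → ℝ), Literature.Analysis.FluidPDE.IsMaximalSmoothSolution ν 0 u p T → Literature.Analysis.FluidPDE.IsLerayHopfOn T ν 0 (u 0) u → Literature.Analysis.FluidPDE.HasRapidSpatialDecay (u 0) → ∃ K : ℝ, ∀ t ∈ Set.Ico 0 T, ∫⁻ x, ‖Literature.Analysis.FluidPDE.curl (u t) x‖ₑ ^ 2 ≤ ENNReal.ofReal (K / Real.sqrt (T - t))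

/-- item stmt-NavierStokesRegularity-22145 · support · rank 9 · closed · proved by Summit.NavierStokesRegularity.NavierStokesRegularity.Theorems.lerayQuarterDissipation_recordTimeTypeI_proof (prover) · by planner
sources: KochNadirashviliSereginSverak2009, Leray1934, RobinsonRodrigoSadowski2016
[support] RECORD-TIME CAPACITY LEMMA (eI ⇒ vI): for a classical Leray–Hopf solution on [0,T) from a
rapidly decaying datum, the quarter-rate enstrophy bound ∫|curl u(t)|² ≤ K/√(T−t) on [0,T) implies
the velocity Type-I rate `IsTypeIBlowup u T` (‖u(t)‖_∞ ≤ C′/√(T−t) eventually). Proof sketch: at a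
time t where ‖u(t)‖_∞ = A is at least half the running maximum, |u| ≤ 2A on [t−ν/A², t]×ℝ³, so
KNSS/Kato smoothing gives ‖∇u(t)‖_∞ ≤ C₀A²/ν, hence |u(t)| ≥ A/2 on a ball of radius ν/(4C₀A) about
a near-maximiser, and Sobolev Ḣ¹(ℝ³) ⊂ L⁶ gives ‖∇u(t)‖²₂ = ‖curl u(t)‖²₂ ≥ cνA; the running maximum
is attained at such times, so ‖u(t)‖_∞ ≤ K/(cν√(T−t)) for all t. [difficulty: M] -/
@[route_item "route-NavierStokesRegularity-LerayQuarterDissipation", crux]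
def RecordTimeTypeI : Prop :=
  ∀ (ν T : ℝ), 0 < ν → 0 < T → ∀ (u : ℝ → EuclideanSpace ℝ (Fin 3) → EuclideanSpace ℝ (Fin 3)) (p : ℝ → EuclideanSpace ℝ (Fin 3) → ℝ), Literature.Analysis.FluidPDE.IsClassicalNSSolutionOn (Set.Ico 0 T) ν 0 u p → Literature.Analysis.FluidPDE.IsLerayHopfOn T ν 0 (u 0) u → Literature.Analysis.FluidPDE.HasRapidSpatialDecay (u 0) → ∀ K : ℝ, (∀ t ∈ Set.Ico 0 T, ∫⁻ x, ‖Literature.Analysis.FluidPDE.curl (u t) x‖ₑ ^ 2 ≤ ENNReal.ofReal (K / Real.sqrt (T - t))) → Literature.Analysis.FluidPDE.IsTypeIBlowup u T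

-- `RecordTimeTypeI` holds: proved by `Summit.NavierStokesRegularity.NavierStokesRegularity.Theorems.lerayQuarterDissipation_recordTimeTypeI_proof` (its module imports this route file, so no `_holds` link can be stated here).

/-- item stmt-NavierStokesRegularity-22146 · support · rank 9 · closed · proved by Summit.NavierStokesRegularity.NavierStokesRegularity.Theorems.lerayQuarterDissipation_dissipativeZoom_proof (prover) · by planner
sources: AlbrittonBarker2019, KochNadirashviliSereginSverak2009, SereginSverak2009, LemarieRieusset2016
[support] DISSIPATIVE ZOOM: at a backward-singular point (T,x₀) of a velocity-Type-I classical
Leray–Hopf solution from a rapidly decaying datum obeying the quarter-rate enstrophy bound with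
constant K, some KNSS/Albritton–Barker zoom limit ū is a Type-I ancient mild solution in the KNSS
gauge, obeys the GLOBAL dissipation law ∫_ℝ³‖∇ū(s)‖² ≤ K′/√(−s) for all s<0, and is unbounded on
every backward cylinder at the origin. Proof sketch: the in-tree `singularZoom_zoomLimit`
(Theorems/SqueezeCycleSingularZoom.lean) supplies the profile and its apex singularity; the rescaled
gradients (αR)·∇u(T+β s, x₀+R y) have ∫_ℝ³|·|²dy = λ‖∇u(t)‖²₂ ≤ K(−s)^(−1/2)·ν-factor (scale
invariance of the quarter law, ‖∇u‖₂ = ‖curl u‖₂ for divergence-free H¹ fields), and Fatou/lower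
semicontinuity under the weak L²_loc convergence of gradients used in that proof passes the bound to
ū. [difficulty: L] -/
@[route_item "route-NavierStokesRegularity-LerayQuarterDissipation", crux]
def DissipativeZoom : Prop :=
  ∀ (ν T : ℝ), 0 < ν → 0 < T → ∀ (u : ℝ → EuclideanSpace ℝ (Fin 3) → EuclideanSpace ℝ (Fin 3)) (p : ℝ → EuclideanSpace ℝ (Fin 3) → ℝ), Literature.Analysis.FluidPDE.IsClassicalNSSolutionOn (Set.Ico 0 T) ν 0 u p → Literature.Analysis.FluidPDE.IsLerayHopfOn T ν 0 (u 0) u → Literature.Analysis.FluidPDE.HasRapidSpatialDecay (u 0) → Literature.Analysis.FluidPDE.IsTypeIBlowup u T → ∀ K : ℝ, (∀ t ∈ Set.Ico 0 T, ∫⁻ x, ‖Literature.Analysis.FluidPDE.curl (u t) x‖ₑ ^ 2 ≤ ENNReal.ofReal (K / Real.sqrt (T - t))) → ∀ x₀ : EuclideanSpace ℝ (Fin 3), (∀ r : ℝ, 0 < r → r ^ 2 < T → eLpNorm (Function.uncurry u) ⊤ (volume.restrict (Literature.Analysis.FluidPDE.parabolicCylinder r ((T : ℝ), x₀))) = ⊤)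 → ∃ (C K' : ℝ) (ū : ℝ → EuclideanSpace ℝ (Fin 3) → EuclideanSpace ℝ (Fin 3)), Literature.Analysis.FluidPDE.IsTypeIAncientMild C ū ∧ (∀ s : ℝ, s < 0 → ∫⁻ x, ‖fderiv ℝ (ū s) x‖ₑ ^ 2 ≤ ENNReal.ofReal (K' / Real.sqrt (-s))) ∧ (∀ r > 0, ∀ M : ℝ, ∃ t ∈ Set.Ioo (-(r ^ 2)) (0 : ℝ), ∃ x ∈ Metric.ball (0 : EuclideanSpace ℝ (Fin 3)) r, M < ‖ū t x‖)

-- `DissipativeZoom` holds: proved by `Summit.NavierStokesRegularity.NavierStokesRegularity.Theorems.lerayQuarterDissipation_dissipativeZoom_proof` (its module imports this route file, so no `_holds` link can be stated here).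

/-- item stmt-NavierStokesRegularity-22147 · assembly · rank 1 · closed · proved by Summit.NavierStokesRegularity.NavierStokesRegularity.Theorems.lerayQuarterDissipation_assembly_proof (prover) · by planner
sources: LemarieRieusset2016, KochNadirashviliSereginSverak2009
[assembly] EnstrophyQuarterLaw → RecordTimeTypeI → DissipativeZoom → FiniteDissipationLiouville →
Clay (A). -/
@[route_item "route-NavierStokesRegularity-LerayQuarterDissipation"]
def Assembly : Prop :=
  EnstrophyQuarterLaw → RecordTimeTypeI → DissipativeZoom → FiniteDissipationLiouville → NavierStokesRegularity

-- `Assembly` holds: proved by `Summit.NavierStokesRegularity.NavierStokesRegularity.Theorems.lerayQuarterDissipation_assembly_proof` (its module imports this route file, so no `_holds` link can be stated here).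

/-! D-0027 §2.1 — DECIDING THEOREM (planner-authored via `route open/edit --closes-file`; by planner-ns-idea-3-g0-0 2026-08-27T20:34:42Z):
its hypotheses are this route's items and its conclusion the sub-problem Statement (glue_lint), and it elaborates with this file. -/

@[closes "route-NavierStokesRegularity-LerayQuarterDissipation"] theorem closes (hQ : EnstrophyQuarterLaw) (hR : RecordTimeTypeI) (hZ : DissipativeZoom)
    (hL : FiniteDissipationLiouville) : NavierStokesRegularity := by
  refine Summit.NavierStokesRegularity.NavierStokesRegularity.Theorems.navierStokesRegularity_of_noBlowup ?_
  intro ν T hν hT u p hcl hLH hdec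
  by_contra hext
  obtain ⟨K, hK⟩ := hQ ν T hν hT u p ⟨hcl, hext⟩ hLH hdec
  have hI : Literature.Analysis.FluidPDE.IsTypeIBlowup u T := hR ν T hν hT u p hcl hLH hdec K hK
  obtain ⟨x₀, hx₀⟩ :=
    Literature.Analysis.FluidPDE.exists_singularPoint_of_classical_of_not_hasSmoothExtensionPast
      hν hT hcl hLH hdec hext
  obtain ⟨C, K', ū, hū, hD, hsing⟩ := hZ ν T hν hT u p hcl hLH hdec hI K hK x₀ hx₀
  exact hL C K' ū hū hD hsing

end Summit.NavierStokesRegularity.NavierStokesRegularity.Theses.LerayQuarterDissipation
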